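import Literature.NumberTheory.Automorphic.ArchRankinSelbergIntegrableGL2
import Literature.NumberTheory.Automorphic.ArchTorusCoordinatesGL2
import HarnessLib

/-!
# Invariance of the `K_∞`-average of a product of two Kirillov functions of `GL₂(K_∞)`
# (Humphries–Jo (2024), §5, proof of Prop. 5.2: "for `z ∈ F^×` and `k ∈ K_n`, we have that `Φ(z e_n k^{-1}) = χ_π χ_σ(z/‖z‖) …`")

Topic `NumberTheory/Automorphic`; namespace `Literature.NumberTheory.Automorphic`. Theorems only (no
definition, no named fact, no instance). After the torus reduction of the archimedean `GL₂ × GL₂`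
Rankin–Selberg integral (`ArchRankinSelbergTorusReductionGL2`) the representation theory sits in the
`K_∞`-average
`H(t) = ∫_{K_∞} P(k) W_{τ(k)e}(a(t)) conj W'_{τ'(k)e'}(a(t)) dμ_K(k)`
(`W_v(a(t)) = kirillovFn`, `μ_K` a left-invariant measure on `K_∞ = Kinf 2 K`). Two substitutions
`k ↦ k₁ k` in this integral, with `k₁ ∈ K_∞` DIAGONAL, give its basic invariance properties:

* `kAverage_kirillov_mul_eq` — for `k₁ = diag(u, 1) ∈ K_∞` (`u ∈ K_∞ˣ` of modulus one at every place)
  and `P(diag(u,1) k) = P(k)` (e.g. `P` a function of the last row of `k`): `H(t u) = H(t)` — the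
  `K_∞`-average is RADIAL on `K_∞ˣ`, whatever `e, e'`;
* `kAverage_kirillov_central` — for `k₁ = ζ · 1 ∈ K_∞` central, the centre acting by `ω, ω'` and
  `P(ζ k) = χ P(k)` (e.g. `P` homogeneous in the last row): `H(t) = χ ω(ζ) conj ω'(ζ) · H(t)`, so
  `H(t) ≠ 0` forces `χ ω(ζ) conj ω'(ζ) = 1` (`kAverage_kirillov_central_eq_one`) — the compatibility of
  the degree of `P` with the central characters that makes Tate's factor radial;
* the matrix lemmas feeding them: `glDiagonal_mem_Kinf` (a diagonal matrix with entries of modulus one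
  lies in `K_∞`), `lastRow_diagGL2_one_mul` (the last row of `diag(u,1) k` is that of `k`),
  `lastRow_glDiagonal_const_mul` (the last row of `(ζ · 1) k` is `ζ` times that of `k`).

## References

* P. Humphries, Y. Jo, *Test vectors for archimedean period integrals*, Publ. Mat. 68 (2024), §5,
  proof of Prop. 5.2 [HumphriesJo2024].
* H. Jacquet, *Automorphic Forms on GL(2), Part II*, LNM 278 (1972), §17–§19 [Jacquet1972GL2II].
-/

noncomputable section

open MeasureTheory Measure NumberField NumberField.mixedEmbedding NumberField.InfinitePlace IsDedekindDomain Set Filter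
open scoped MatrixGroups ENNReal NNReal Classical ComplexConjugate

namespace Literature.NumberTheory.Automorphic

-- as in `ArchGardingWhittaker` / `ArchRankinSelbergIntegrableGL2`
set_option backward.isDefEq.respectTransparency false

variable {K : Type} [Field K] [NumberField K]

/-! ### 1. Matrix lemmas -/

section Matrices

/-- **A diagonal matrix with entries of modulus one lies in `K_∞`** (`K_∞ = U(2, K_∞)`, `star dᵢ · dᵢ = 1`). [folklore] -/
theorem glDiagonal_mem_Kinf {n : ℕ} {d : Fin n → (mixedSpace K)ˣ} (hd : ∀ i, star ((d i : (mixedSpace K)ˣ) : mixedSpace K) * (d i) = 1) :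
    glDiagonal n (mixedSpace K) d ∈ Kinf n K := by
  rw [Kinf_eq_unitarySubgroupGL, mem_unitarySubgroupGL_iff, coe_glDiagonal, Matrix.star_eq_conjTranspose,
    Matrix.diagonal_conjTranspose, Matrix.diagonal_mul_diagonal, ← Matrix.diagonal_one]
  congr 1
  funext i
  exact hd i

omit [NumberField K] in
/-- The last row of `diag(u, 1) k` is the last row of `k`. [folklore] -/
theorem lastRow_diagGL2_one_mul (u : (mixedSpace K)ˣ) (k : GL (Fin 2) (mixedSpace K)) (j : Fin 2) :
    ((diagGL2 u 1 * k : GL (Fin 2) (mixedSpace K)) : Matrix (Fin 2) (Fin 2) (mixedSpace K)) (Fin.last 1) j =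
      (k : Matrix (Fin 2) (Fin 2) (mixedSpace K)) (Fin.last 1) j := by
  rw [Units.val_mul, coe_diagGL2, Matrix.mul_apply, Fin.sum_univ_two]
  simp [show (Fin.last 1 : Fin 2) = 1 from rfl]

omit [NumberField K] in
/-- The last row of `(ζ · 1) k` is `ζ` times the last row of `k`. [folklore] -/
theorem lastRow_glDiagonal_const_mul (ζ : (mixedSpace K)ˣ) (k : GL (Fin 2) (mixedSpace K)) (j : Fin 2) :
    ((glDiagonal 2 (mixedSpace K) (fun _ => ζ) * k : GL (Fin 2) (mixedSpace K)) : Matrix (Fin 2) (Fin 2) (mixedSpace K)) (Fin.last 1) j =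
      (ζ : mixedSpace K) * (k : Matrix (Fin 2) (Fin 2) (mixedSpace K)) (Fin.last 1) j := by
  rw [Units.val_mul, coe_glDiagonal, Matrix.diagonal_mul]

end Matrices

/-! ### 2. The substitutions `k ↦ k₁ k` in the `K_∞`-average -/

section Average

variable {hcpt : isCompact_glFiniteIntegralLevel 2 K}
  {E : Type*} [NormedAddCommGroup E] [NormedSpace ℂ E] [CompleteSpace E]
  {E' : Type*} [NormedAddCommGroup E'] [NormedSpace ℂ E'] [CompleteSpace E']
  {τ : ContRepresentation ℂ (AutomorphyDatum.gl 2 K hcpt).arch.carrier E} (hτ : τ.IsStronglyContinuous)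
  {τ' : ContRepresentation ℂ (AutomorphyDatum.gl 2 K hcpt).arch.carrier E'} (hτ' : τ'.IsStronglyContinuous)

/-- `W_{τ(diag(u,1) k) e}(a(t)) = W_{τ(k) e}(a(t u))`: a diagonal `K_∞`-translate shifts the argument of the
Kirillov function. [folklore] -/
theorem kirillovFn_gardingAct_diagGL2_one_mul (ℓ : archGardingSpace hcpt τ →ₗ[ℂ] ℂ) (e : archGardingSpace hcpt τ)
    (u t : (mixedSpace K)ˣ) (k : GL (Fin 2) (mixedSpace K)) :
    kirillovFn hτ ℓ (gardingAct hτ (diagGL2 u 1 * k) e) t = kirillovFn hτ ℓ (gardingAct hτ k e) (t * u) := by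
  rw [mul_comm t u, kirillovFn_mul, kirillovFn_eq_apply_gardingAct, gardingAct_mul, Module.End.mul_apply]

variable [MeasurableSpace (GL (Fin 2) (mixedSpace K))] [BorelSpace (GL (Fin 2) (mixedSpace K))]

/-- **The `K_∞`-average of a product of Kirillov functions is radial.** For `u ∈ K_∞ˣ` with
`diag(u, 1) ∈ K_∞`, a weight `P` with `P(diag(u,1) k) = P(k)` and a left-invariant measure `μ_K` on `K_∞`:
`∫ P(k) W_{τ(k)e}(a(tu)) conj W'_{τ'(k)e'}(a(tu)) dμ_K = ∫ P(k) W_{τ(k)e}(a(t)) conj W'_{τ'(k)e'}(a(t)) dμ_K`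
(substitute `k ↦ diag(u,1) k`). [cite: HumphriesJo2024, §5, proof of Prop. 5.2 (p. 152)] -/
theorem kAverage_kirillov_mul_eq (ℓ : archGardingSpace hcpt τ →ₗ[ℂ] ℂ) (ℓ' : archGardingSpace hcpt τ' →ₗ[ℂ] ℂ)
    (e : archGardingSpace hcpt τ) (e' : archGardingSpace hcpt τ') (Pk : GL (Fin 2) (mixedSpace K) → ℂ)
    (μK : Measure ↥(Kinf 2 K)) [μK.IsMulLeftInvariant]
    {u : (mixedSpace K)ˣ} (hu : (diagGL2 u 1 : GL (Fin 2) (mixedSpace K)) ∈ Kinf 2 K)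
    (hP : ∀ k : GL (Fin 2) (mixedSpace K), Pk (diagGL2 u 1 * k) = Pk k) (t : (mixedSpace K)ˣ) :
    ∫ k : ↥(Kinf 2 K), Pk (k : GL (Fin 2) (mixedSpace K)) *
        (kirillovFn hτ ℓ (gardingAct hτ (k : GL (Fin 2) (mixedSpace K)) e) (t * u) *
          conj (kirillovFn hτ' ℓ' (gardingAct hτ' (k : GL (Fin 2) (mixedSpace K)) e') (t * u))) ∂μK =
      ∫ k : ↥(Kinf 2 K), Pk (k : GL (Fin 2) (mixedSpace K)) *
        (kirillovFn hτ ℓ (gardingAct hτ (k : GL (Fin 2) (mixedSpace K)) e) t *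
          conj (kirillovFn hτ' ℓ' (gardingAct hτ' (k : GL (Fin 2) (mixedSpace K)) e') t)) ∂μK := by
  haveI : MeasurableMul ↥(Kinf 2 K) := by
    haveI : SecondCountableTopology (GL (Fin 2) (mixedSpace K)) := secondCountableTopology_glInf 2 K
    exact ContinuousMul.measurableMul
  set k₁ : ↥(Kinf 2 K) := ⟨diagGL2 u 1, hu⟩ with hk₁
  set F : ↥(Kinf 2 K) → ℂ := fun k => Pk (k : GL (Fin 2) (mixedSpace K)) *
    (kirillovFn hτ ℓ (gardingAct hτ (k : GL (Fin 2) (mixedSpace K)) e) t *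
      conj (kirillovFn hτ' ℓ' (gardingAct hτ' (k : GL (Fin 2) (mixedSpace K)) e') t)) with hF
  have hpt : ∀ k : ↥(Kinf 2 K), Pk (k : GL (Fin 2) (mixedSpace K)) *
      (kirillovFn hτ ℓ (gardingAct hτ (k : GL (Fin 2) (mixedSpace K)) e) (t * u) *
        conj (kirillovFn hτ' ℓ' (gardingAct hτ' (k : GL (Fin 2) (mixedSpace K)) e') (t * u))) = F (k₁ * k) := by
    intro k
    simp only [hF, hk₁, Subgroup.coe_mul]
    rw [hP, kirillovFn_gardingAct_diagGL2_one_mul, kirillovFn_gardingAct_diagGL2_one_mul]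
  simp_rw [hpt]
  exact integral_mul_left_eq_self F k₁

/-- **The central substitution.** For `ζ ∈ K_∞ˣ` with `ζ · 1 ∈ K_∞`, the centre acting in `τ, τ'` by
`ω, ω'`, a weight with `P((ζ · 1) k) = χ P(k)` and a left-invariant `μ_K`:
`∫ P W_{τ(k)e}(a(t)) conj W'_{τ'(k)e'}(a(t)) dμ_K = χ ω(ζ) conj ω'(ζ) · ∫ P W_{τ(k)e}(a(t)) conj W'_{τ'(k)e'}(a(t)) dμ_K`
(substitute `k ↦ (ζ · 1) k`). [cite: HumphriesJo2024, §5, proof of Prop. 5.2 (p. 152)] -/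
theorem kAverage_kirillov_central (ℓ : archGardingSpace hcpt τ →ₗ[ℂ] ℂ) (ℓ' : archGardingSpace hcpt τ' →ₗ[ℂ] ℂ)
    (e : archGardingSpace hcpt τ) (e' : archGardingSpace hcpt τ') (Pk : GL (Fin 2) (mixedSpace K) → ℂ)
    (μK : Measure ↥(Kinf 2 K)) [μK.IsMulLeftInvariant]
    {ω ω' : (mixedSpace K)ˣ → ℂ}
    (hω : ∀ (c : (mixedSpace K)ˣ) (v : E), τ (toArch hcpt (glDiagonal 2 (mixedSpace K) fun _ => c)) v = ω c • v)
    (hω' : ∀ (c : (mixedSpace K)ˣ) (v : E'), τ' (toArch hcpt (glDiagonal 2 (mixedSpace K) fun _ => c)) v = ω' c • v)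
    {ζ : (mixedSpace K)ˣ} (hζ : glDiagonal 2 (mixedSpace K) (fun _ => ζ) ∈ Kinf 2 K) {χ : ℂ}
    (hP : ∀ k : GL (Fin 2) (mixedSpace K), Pk (glDiagonal 2 (mixedSpace K) (fun _ => ζ) * k) = χ * Pk k)
    (t : (mixedSpace K)ˣ) :
    ∫ k : ↥(Kinf 2 K), Pk (k : GL (Fin 2) (mixedSpace K)) *
        (kirillovFn hτ ℓ (gardingAct hτ (k : GL (Fin 2) (mixedSpace K)) e) t *
          conj (kirillovFn hτ' ℓ' (gardingAct hτ' (k : GL (Fin 2) (mixedSpace K)) e') t)) ∂μK =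
      χ * (ω ζ * conj (ω' ζ)) * ∫ k : ↥(Kinf 2 K), Pk (k : GL (Fin 2) (mixedSpace K)) *
        (kirillovFn hτ ℓ (gardingAct hτ (k : GL (Fin 2) (mixedSpace K)) e) t *
          conj (kirillovFn hτ' ℓ' (gardingAct hτ' (k : GL (Fin 2) (mixedSpace K)) e') t)) ∂μK := by
  haveI : MeasurableMul ↥(Kinf 2 K) := by
    haveI : SecondCountableTopology (GL (Fin 2) (mixedSpace K)) := secondCountableTopology_glInf 2 K
    exact ContinuousMul.measurableMul
  set k₀ : ↥(Kinf 2 K) := ⟨glDiagonal 2 (mixedSpace K) (fun _ => ζ), hζ⟩ with hk₀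
  set F : ↥(Kinf 2 K) → ℂ := fun k => Pk (k : GL (Fin 2) (mixedSpace K)) *
    (kirillovFn hτ ℓ (gardingAct hτ (k : GL (Fin 2) (mixedSpace K)) e) t *
      conj (kirillovFn hτ' ℓ' (gardingAct hτ' (k : GL (Fin 2) (mixedSpace K)) e') t)) with hF
  -- the centre acts by scalars on the Gårding space
  have hcen : ∀ v : archGardingSpace hcpt τ, gardingAct hτ (glDiagonal 2 (mixedSpace K) fun _ => ζ) v = ω ζ • v :=
    fun v => Subtype.ext (hω ζ (v : E))
  have hcen' : ∀ v : archGardingSpace hcpt τ', gardingAct hτ' (glDiagonal 2 (mixedSpace K) fun _ => ζ) v = ω' ζ • v :=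
    fun v => Subtype.ext (hω' ζ (v : E'))
  have hpt : ∀ k : ↥(Kinf 2 K), F (k₀ * k) = χ * (ω ζ * conj (ω' ζ)) * F k := by
    intro k
    simp only [hF, hk₀, Subgroup.coe_mul]
    rw [hP, gardingAct_mul, gardingAct_mul, Module.End.mul_apply, Module.End.mul_apply, hcen, hcen', kirillovFn_smul,
      kirillovFn_smul, Pi.smul_apply, Pi.smul_apply, smul_eq_mul, smul_eq_mul, map_mul]
    ring
  calc ∫ k, F k ∂μK = ∫ k, F (k₀ * k) ∂μK := (integral_mul_left_eq_self F k₀).symm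
    _ = ∫ k, χ * (ω ζ * conj (ω' ζ)) * F k ∂μK := integral_congr_ae (Eventually.of_forall hpt)
    _ = χ * (ω ζ * conj (ω' ζ)) * ∫ k, F k ∂μK := integral_const_mul _ _

/-- **Compatibility of the weight with the central characters.** In the situation of
`kAverage_kirillov_central`, if the `K_∞`-average does not vanish then `χ ω(ζ) conj ω'(ζ) = 1`: a
homogeneous weight `P` can pair `e` with `e'` only if its degree character cancels `ω conj ω'` on the
compact part of the centre. [cite: HumphriesJo2024, §5, proof of Prop. 5.2 (p. 152)] -/
theorem kAverage_kirillov_central_eq_one (ℓ : archGardingSpace hcpt τ →ₗ[ℂ] ℂ) (ℓ' : archGardingSpace hcpt τ' →ₗ[ℂ] ℂ)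
    (e : archGardingSpace hcpt τ) (e' : archGardingSpace hcpt τ') (Pk : GL (Fin 2) (mixedSpace K) → ℂ)
    (μK : Measure ↥(Kinf 2 K)) [μK.IsMulLeftInvariant]
    {ω ω' : (mixedSpace K)ˣ → ℂ}
    (hω : ∀ (c : (mixedSpace K)ˣ) (v : E), τ (toArch hcpt (glDiagonal 2 (mixedSpace K) fun _ => c)) v = ω c • v)
    (hω' : ∀ (c : (mixedSpace K)ˣ) (v : E'), τ' (toArch hcpt (glDiagonal 2 (mixedSpace K) fun _ => c)) v = ω' c • v)
    {ζ : (mixedSpace K)ˣ} (hζ : glDiagonal 2 (mixedSpace K) (fun _ => ζ) ∈ Kinf 2 K) {χ : ℂ}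
    (hP : ∀ k : GL (Fin 2) (mixedSpace K), Pk (glDiagonal 2 (mixedSpace K) (fun _ => ζ) * k) = χ * Pk k)
    {t : (mixedSpace K)ˣ}
    (hne : ∫ k : ↥(Kinf 2 K), Pk (k : GL (Fin 2) (mixedSpace K)) *
        (kirillovFn hτ ℓ (gardingAct hτ (k : GL (Fin 2) (mixedSpace K)) e) t *
          conj (kirillovFn hτ' ℓ' (gardingAct hτ' (k : GL (Fin 2) (mixedSpace K)) e') t)) ∂μK ≠ 0) :
    χ * (ω ζ * conj (ω' ζ)) = 1 := by
  have h := kAverage_kirillov_central hτ hτ' ℓ ℓ' e e' Pk μK hω hω' hζ hP t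
  conv_lhs at h => rw [← one_mul (∫ k : ↥(Kinf 2 K), Pk (k : GL (Fin 2) (mixedSpace K)) *
        (kirillovFn hτ ℓ (gardingAct hτ (k : GL (Fin 2) (mixedSpace K)) e) t *
          conj (kirillovFn hτ' ℓ' (gardingAct hτ' (k : GL (Fin 2) (mixedSpace K)) e') t)) ∂μK)]
  exact (mul_right_cancel₀ hne h).symm

end Average

end Literature.NumberTheory.Automorphic
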